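import Summits.ABC.IUTFork.Repair.RHHeightClassSigma
import Summits.ABC.IUTFork.Repair.RH2SigmaHullRow8
import HarnessLib

/-!
# D-0079 RESCUE sub-cell R-H, ROUND 2 (D-0107) Q2(8), companion of `Repair/RHHeightClassSigma.lean` — row 8 «heightclass» AT THE GENUINE BED:
# any realising ideles of `pilotDataOfK D K`, and the NUMBER-level Cor. 3.12 at every genuine datum in Σ₈ (as typed)

PROOF-ONLY file (D-0012: 0 definitions, 0 `Prop` facts; abc-iut cell, rung LADDER-ABC:A2.RESCUE.H; seat abc-iut-rh-typ-8 gen 3 = R-H ROUND 2 TRANCHE 1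
payload (4) «row 8: Q2(8)», director-abc g3 2026-08-26T19:46:32Z; `plan/rescue/R-H/ROUND2/START-HERE.md` v1.0 §1–§2 Q2 target shape for DATUM-strata
rows: «∀ D ∈ Σ_row, S_H-window D (door, landed) ∘ abc_of_SH_v10K_window ⟹ abc for the data in Σ_row»). TAKES NO SIDE on [IUTchIII] Cor. 3.12 or on
any author (Mochizuki / Scholze–Stix / Joshi / Dupuy–Hilado); `RHHeightClass.HBand` (abc-iut-lens-strengthen-1, p459046) is an R-H CANDIDATE = a
claim-tagged HYPOTHESIS, refuted POOLED on the genuine table (k1 56.7 %, ROUND1.tsv row 8) and TRUE exactly on the stratum Σ₈ («HEX: k ≤ k₀(p,e_w,l)»);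
nothing here asserts abc proved or refuted, or that any genuine datum lies in Σ₈ (Q3, rh2-q3-num / rh2-q3-typ-1); typed ≠ proved; instantiated ≠ endorsed.

CONTEXT (three hands met on row 8's discharge, all landed): the companion `RHHeightClassSigma.qRegion_subset_thetaHull_settingPrVolSharp_of_hBand`
(p470468: ANY pilot datum `X` with `TwoMulLDvdOrdq X`, ANY realising idele pair — `HBand X` alone ⟹ `qRegion ⊆ thetaHull` at every packet),
abc-iut-rp-m2's `RHHeightClassK2.exists_qPinned_and_hull_settingPrVolSharp_of_hBand` (the intrinsic dictionary, idele profile as binders) and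
abc-iut-rh2-q2-hull's `RH2SigmaHullRow8` (row 8 ⊆ row 15 at the datum level; at the CHOSEN realising ideles of the window certificates:
`RH2SigmaHull.pilotKummerCompatHull_chosen_of_hBand`, and the certificate `RH2SigmaHull.abc_of_hBand_v10K_window` = p447945 with `hSHw` ↦ «every admissible
window datum satisfies `HBand`», explicit 3 = Σ₈(window) · NUM(deep) · CONE). Those are CITED here, not restated. WHAT THIS FILE ADDS (tree names only):
* §6 `qRegion_subset_thetaHull_settingPrVolSharp_pilotDataOfK_of_hBand` — the companion at abc-iut-C-cert-3's `Cor312Prov.pilotDataOfK D K`, where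
  [IUTchI] Ex. 3.2 (iv) is the THEOREM `Cor312Prov.twoMulLDvdOrdq_pilotDataOfK`: for ANY realising idele pair (not only the chosen one) and any analytic
  logarithm family, `HBand (pilotDataOfK D K) ⟹ ∀ j v_ℚ, qRegion ⊆ thetaHull` — no other hypothesis.
* §7 `cor312Of_of_hBand` — **the NUMBER-level [IUTchIII] Cor. 3.12 `I.Cor312Of` (`−|log(q)| ≤ −|log(Θ)|`) holds AT EVERY GENUINE DATUM IN Σ₈, as typed**:
  `HBand (pilotDataOfK D K) → I.Cor312Of` for every genuine Θ-volume input `I` of `D` (given any context binders of the bed of record `analyticLogv K`):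
  abc-iut-C-cert-3's `Conditional.GenuineK.cor312Of_of_SH` with `hSH` := abc-iut-rh2-q2-hull's `RH2SigmaHull.pilotKummerCompatHull_chosen_of_hBand`,
  `hQPin` := `rfl` (constant reading), `hΘ` := abc-iut-s2-p6's THEOREM `Thm311.Real.negLogTheta_settingPrVolSharp_pilotDataOfK_le_genuine`, side
  conditions := the chosen ideles' `choose_spec`. For a DATUM-stratum row the «weakened Cor. 3.12» of Q2 is Cor. 3.12 VERBATIM on Σ₈ (no off-Σ cell
  inside a kept datum; Q1 word MOOT-ON-DATUM-Σ(8)); the Σ₈ → `ABC` composition is rh2-q2-hull's certificate above.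
HONEST SCOPE: OUR typed objects throughout (Dupuy–Hilado's (Ind2), STRONGER-THAN-PRINT; SHARP boxes; hull-level reading of Step (xi-f)); «Cor. 3.12
follows AT THIS DATUM from the candidate AS TYPED», nothing more. Standard axioms. [cite: DupuyHilado2025, §3.3, §3.4, §3.9, §4.9] [cite: WeilBNT1967, Ch. II §2, Th. 1]
[cite: Mochizuki2012, IUTchI Ex. 3.2 (iv) p. 71; IUTchIII Cor. 3.12 p. 173–174, Step (xi-f) p. 184; IUTchIV Thm. 1.10 p. 23] [claim: Mochizuki2012, status: disputed]
-/
noncomputable section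

open Set Function
open scoped Pointwise

namespace Summit.ABC.IUTFork.Repair.RHHeightClassSigma

open Thm311 Thm311.Real Cor312 Cor312.Setting Cor312Vol Literature.IUT.LogThetaLattice Literature.IUT.LogVolume
open Literature.NumberTheory.NumberFields NumberField IsDedekindDomain Metric RHLevelMover RHSlotReach

/-! ## §6. At the GENUINE `K`-level bed `pilotDataOfK D K`: Ex. 3.2 (iv) is a theorem — any realising idele pair -/

section Genuine

open Cor312Prov Literature.IUT.HodgeTheaters

variable {F K Fbar : Type} [Field F] [NumberField F] [Field K] [NumberField K] [Algebra F K] [Field Fbar]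
  [Algebra F Fbar] [Algebra K Fbar] {E : WeierstrassCurve F} [E.IsElliptic] {l : ℕ} {Pb : BadPlacePredicates K}
  (D : InitialThetaData F K Fbar E l Pb) {logv : PadicLogs K} (hlog : LogvAnalytic logv)
  (M : Type) [Field M] [NumberField M]
  (archPk : ∀ (j : (thetaIndex (pilotDataOfK D K)).Label) (vQ : (thetaIndex (pilotDataOfK D K)).VQ), Set ((logShellsDH (pilotDataOfK D K) logv).Packet j vQ))
  (archSub : ∀ (j : (thetaIndex (pilotDataOfK D K)).Label) (v : (thetaIndex (pilotDataOfK D K)).V),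
    Set ((logShellsDH (pilotDataOfK D K) logv).Packet j ((thetaIndex (pilotDataOfK D K)).over v)))
  (Ψ : ℤ → ∀ v : (thetaIndex (pilotDataOfK D K)).V, v ∈ (thetaIndex (pilotDataOfK D K)).Vbad → Set ((logShellsDH (pilotDataOfK D K) logv).StarPacket v))
  (act : ℤ → ∀ v : (thetaIndex (pilotDataOfK D K)).V, v ∈ (thetaIndex (pilotDataOfK D K)).Vbad →
    (logShellsDH (pilotDataOfK D K) logv).StarPacket v → Module.End ℚ ((logShellsDH (pilotDataOfK D K) logv).StarPacket v))
  (Mmod : ℤ → ∀ j : (thetaIndex (pilotDataOfK D K)).LabelStar, Set ((logShellsDH (pilotDataOfK D K) logv).GlobalPacket j.1))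
  (region : ℤ → ∀ j : (thetaIndex (pilotDataOfK D K)).LabelStar, FinDivisor M → ∀ vQ : (thetaIndex (pilotDataOfK D K)).VQ,
    Set ((logShellsDH (pilotDataOfK D K) logv).Packet j.1 vQ))
  (n : ℤ) {HT : Type} {LogLink : HT → HT → Type} {IsFull : ∀ {s t : HT}, LogLink s t → Prop}
  (lat : LGPGaussianLogThetaLattice LogLink IsFull)
  {Frd : Type} {IsoF : Frd → Frd → Type} {Ob : Frd → Type} {realify : Frd → Frd} {Strip : Type}
  {IsoS : Strip → Strip → Type} {Mv : ∀ v : (thetaIndex (pilotDataOfK D K)).V, v ∈ (thetaIndex (pilotDataOfK D K)).Vbad → Type}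
  [∀ v h, Monoid (Mv v h)]
  (sig : GlobalLGPFrobenioidSignature (thetaIndex (pilotDataOfK D K)).lstar (thetaIndex (pilotDataOfK D K)).V (· ∈ (thetaIndex (pilotDataOfK D K)).Vbad)
    Frd IsoF Ob realify Strip IsoS Mv)
  (split : SplittingMonoids Mv) {ObΔ : Type} {N : ∀ v : (thetaIndex (pilotDataOfK D K)).V, v ∈ (thetaIndex (pilotDataOfK D K)).Vbad → Type}
  [∀ v h, Monoid (N v h)] (qData : QPilotData ObΔ N)

/-- **Row 8 at the genuine bed, ANY realising ideles.** For the `K`-level Dupuy–Hilado pilot datum `pilotDataOfK D K` of an initial Θ-datum `D`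
(abc-iut-C-cert-3), [IUTchI] Ex. 3.2 (iv) `2l ∣ ord_w(q_w)` is the THEOREM `Cor312Prov.twoMulLDvdOrdq_pilotDataOfK`, so §5 needs only the realising
idele pair and the candidate: `HBand (pilotDataOfK D K) ⟹ ∀ j v_ℚ, qRegion ⊆ thetaHull` at `settingPrVolSharp (pilotDataOfK D K) …`.
[cite: Mochizuki2012, IUTchI Ex. 3.2 (iv) p. 71] [cite: DupuyHilado2025, §3.3, §3.4, §3.9, §4.9] [claim: Mochizuki2012, status: disputed] -/
theorem qRegion_subset_thetaHull_settingPrVolSharp_pilotDataOfK_of_hBand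
    (tq : ∀ (pp : Nat.Primes) (x : (thetaIndex (pilotDataOfK D K)).Fibre (.inr pp)), haveI : Fact (pp : ℕ).Prime := ⟨pp.2⟩; kOf (pilotDataOfK D K) pp.1 x)
    (t : ∀ (pp : Nat.Primes) (_ : Fin (pilotDataOfK D K).lstar) (x : (thetaIndex (pilotDataOfK D K)).Fibre (.inr pp)),
      haveI : Fact (pp : ℕ).Prime := ⟨pp.2⟩; kOf (pilotDataOfK D K) pp.1 x)
    (htq0 : ∀ pp x, tq pp x ≠ 0)
    (htq1 : ∀ (pp : Nat.Primes) (x : (thetaIndex (pilotDataOfK D K)).Fibre (.inr pp)),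
      haveI : Fact (pp : ℕ).Prime := ⟨pp.2⟩; placeOf (pilotDataOfK D K) pp.1 x ∉ (pilotDataOfK D K).S → ‖tq pp x‖ = 1)
    (htq : ∀ (pp : Nat.Primes) (x : (thetaIndex (pilotDataOfK D K)).Fibre (.inr pp)), haveI : Fact (pp : ℕ).Prime := ⟨pp.2⟩
      Real.log ‖tq pp x‖ = -((pilotDataOfK D K).qPilot (placeOf (pilotDataOfK D K) pp.1 x)) *
        logNorm K (placeOf (pilotDataOfK D K) pp.1 x) / localDegree K (placeOf (pilotDataOfK D K) pp.1 x))
    (ht0 : ∀ pp i x, t pp i x ≠ 0)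
    (ht1 : ∀ (pp : Nat.Primes) (i : Fin (pilotDataOfK D K).lstar) (x : (thetaIndex (pilotDataOfK D K)).Fibre (.inr pp)),
      haveI : Fact (pp : ℕ).Prime := ⟨pp.2⟩; placeOf (pilotDataOfK D K) pp.1 x ∉ (pilotDataOfK D K).S → ‖t pp i x‖ = 1)
    (ht : ∀ (pp : Nat.Primes) (i : Fin (pilotDataOfK D K).lstar) (x : (thetaIndex (pilotDataOfK D K)).Fibre (.inr pp)),
      haveI : Fact (pp : ℕ).Prime := ⟨pp.2⟩
      Real.log ‖t pp i x‖ = -((pilotDataOfK D K).thetaPilot i (placeOf (pilotDataOfK D K) pp.1 x)) *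
        logNorm K (placeOf (pilotDataOfK D K) pp.1 x) / localDegree K (placeOf (pilotDataOfK D K) pp.1 x))
    (hH : RHHeightClass.HBand (pilotDataOfK D K)) :
    ∀ (j : (thetaIndex (pilotDataOfK D K)).Label) (vQ : (thetaIndex (pilotDataOfK D K)).VQ),
      (settingPrVolSharp (pilotDataOfK D K) hlog M archPk archSub Ψ act Mmod region n lat sig split qData tq t htq0 htq1).qRegion j vQ ⊆
        (settingPrVolSharp (pilotDataOfK D K) hlog M archPk archSub Ψ act Mmod region n lat sig split qData tq t htq0 htq1).thetaHull j vQ :=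
  qRegion_subset_thetaHull_settingPrVolSharp_of_hBand (pilotDataOfK D K) hlog M archPk archSub Ψ act Mmod region n lat sig split qData tq t
    htq0 htq1 (twoMulLDvdOrdq_pilotDataOfK D) htq ht0 ht1 ht hH

end Genuine

/-! ## §7. The NUMBER-level Cor. 3.12 at every genuine datum in Σ₈ -/

section Cor312

open Cor312Prov Literature.IUT.HodgeTheaters Literature.IUT.LogVolume.ThetaData

variable {F K Fbar : Type} [Field F] [NumberField F] [Field K] [NumberField K] [Algebra F K] [Field Fbar]
  [Algebra F Fbar] [Algebra K Fbar] {E : WeierstrassCurve F} [E.IsElliptic] {l : ℕ} {Pb : BadPlacePredicates K}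
  (D : InitialThetaData F K Fbar E l Pb)
  (M : Type) [Field M] [NumberField M]
  (archPk : ∀ (j : (thetaIndex (pilotDataOfK D K)).Label) (vQ : (thetaIndex (pilotDataOfK D K)).VQ),
    Set ((logShellsDH (pilotDataOfK D K) (analyticLogv K)).Packet j vQ))
  (archSub : ∀ (j : (thetaIndex (pilotDataOfK D K)).Label) (v : (thetaIndex (pilotDataOfK D K)).V),
    Set ((logShellsDH (pilotDataOfK D K) (analyticLogv K)).Packet j ((thetaIndex (pilotDataOfK D K)).over v)))
  (Ψ : ℤ → ∀ v : (thetaIndex (pilotDataOfK D K)).V, v ∈ (thetaIndex (pilotDataOfK D K)).Vbad →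
    Set ((logShellsDH (pilotDataOfK D K) (analyticLogv K)).StarPacket v))
  (act : ℤ → ∀ v : (thetaIndex (pilotDataOfK D K)).V, v ∈ (thetaIndex (pilotDataOfK D K)).Vbad →
    (logShellsDH (pilotDataOfK D K) (analyticLogv K)).StarPacket v →
      Module.End ℚ ((logShellsDH (pilotDataOfK D K) (analyticLogv K)).StarPacket v))
  (Mmod : ℤ → ∀ j : (thetaIndex (pilotDataOfK D K)).LabelStar, Set ((logShellsDH (pilotDataOfK D K) (analyticLogv K)).GlobalPacket j.1))
  (region : ℤ → ∀ j : (thetaIndex (pilotDataOfK D K)).LabelStar, FinDivisor M → ∀ vQ : (thetaIndex (pilotDataOfK D K)).VQ,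
    Set ((logShellsDH (pilotDataOfK D K) (analyticLogv K)).Packet j.1 vQ))
  (frobAdm : ℤ → ℤ → ∀ (j : (thetaIndex (pilotDataOfK D K)).Label) (vQ : (thetaIndex (pilotDataOfK D K)).VQ),
    Set ((logShellsDH (pilotDataOfK D K) (analyticLogv K)).Packet j vQ) → Prop)
  (frobLogvol : ℤ → ℤ → ∀ (j : (thetaIndex (pilotDataOfK D K)).Label) (vQ : (thetaIndex (pilotDataOfK D K)).VQ),
    Set ((logShellsDH (pilotDataOfK D K) (analyticLogv K)).Packet j vQ) → ℝ)
  (frobΨ : ℤ → ℤ → ∀ v : (thetaIndex (pilotDataOfK D K)).V, v ∈ (thetaIndex (pilotDataOfK D K)).Vbad →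
    Set ((logShellsDH (pilotDataOfK D K) (analyticLogv K)).StarPacket v))
  (frobMmod : ℤ → ℤ → ∀ j : (thetaIndex (pilotDataOfK D K)).LabelStar,
    Set ((logShellsDH (pilotDataOfK D K) (analyticLogv K)).GlobalPacket j.1))
  (unitImage : ℤ → ℤ → ℕ → ∀ (j : (thetaIndex (pilotDataOfK D K)).Label) (vQ : (thetaIndex (pilotDataOfK D K)).VQ),
    Set ((logShellsDH (pilotDataOfK D K) (analyticLogv K)).Packet j vQ))
  (ballImage : ℤ → ℤ → ∀ (j : (thetaIndex (pilotDataOfK D K)).Label) (vQ : (thetaIndex (pilotDataOfK D K)).VQ),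
    Set ((logShellsDH (pilotDataOfK D K) (analyticLogv K)).Packet j vQ))
  (thetaDiv : ℤ → ℤ → LgpDivisor M (thetaIndex (pilotDataOfK D K)).lstar)
  (n : ℤ) {HT : Type} {LogLink : HT → HT → Type} {IsFull : ∀ {s t : HT}, LogLink s t → Prop}
  (lat : LGPGaussianLogThetaLattice LogLink IsFull)
  {Frd : Type} {IsoF : Frd → Frd → Type} {Ob : Frd → Type} {realify : Frd → Frd} {Strip : Type}
  {IsoS : Strip → Strip → Type}
  {Mv : ∀ v : (thetaIndex (pilotDataOfK D K)).V, v ∈ (thetaIndex (pilotDataOfK D K)).Vbad → Type} [∀ v h, Monoid (Mv v h)]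
  (sig : GlobalLGPFrobenioidSignature (thetaIndex (pilotDataOfK D K)).lstar (thetaIndex (pilotDataOfK D K)).V
    (· ∈ (thetaIndex (pilotDataOfK D K)).Vbad) Frd IsoF Ob realify Strip IsoS Mv)
  (split : SplittingMonoids Mv) {ObΔ : Type}
  {N : ∀ v : (thetaIndex (pilotDataOfK D K)).V, v ∈ (thetaIndex (pilotDataOfK D K)).Vbad → Type} [∀ v h, Monoid (N v h)]
  (qData : QPilotData ObΔ N)
  (qK : ∀ v : (thetaIndex (pilotDataOfK D K)).V, v ∈ (thetaIndex (pilotDataOfK D K)).Vbad →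
    Set ((logShellsDH (pilotDataOfK D K) (analyticLogv K)).StarPacket v))

include M archPk archSub Ψ act Mmod region frobAdm frobLogvol frobΨ frobMmod unitImage ballImage thetaDiv n lat sig split qData qK in
/-- **[IUTchIII] Cor. 3.12 AT EVERY GENUINE DATUM IN Σ₈, as typed.** For an initial Θ-datum `D`, ANY genuine Θ-volume input `I` OF `D` (abc-iut-S2),
and any context binders of the bed of record (`analyticLogv K`, CHOSEN realising ideles): if the row-8 candidate holds at the `K`-level pilot datum —
`RHHeightClass.HBand (pilotDataOfK D K)`, i.e. the datum lies in Σ₈ — then `I.Cor312Of` (`−|log(q)| ≤ −|log(Θ)|` of the input). PROOF =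
abc-iut-C-cert-3's `Conditional.GenuineK.cor312Of_of_SH` with `hSH` := abc-iut-rh2-q2-hull's `RH2SigmaHull.pilotKummerCompatHull_chosen_of_hBand`
(constant region reading `ρ := fun _ => qRegion`, so `hQPin := rfl`), `hΘ` := abc-iut-s2-p6's `negLogTheta_settingPrVolSharp_pilotDataOfK_le_genuine`,
side conditions := the chosen ideles' specifications (`Cor312Prov.exists_realising_{q,theta}Ideles_pilotDataOfK`). «Cor. 3.12 follows at this datum
from the candidate AS TYPED», nothing more; no side taken on [IUTchIII] Cor. 3.12. [cite: Mochizuki2012, IUTchIII Cor. 3.12 p. 173–174, Step (xi-f) p. 184; IUTchIV Thm. 1.10 p. 23]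
[cite: DupuyHilado2025, §3.4, §3.9, §4.9] [claim: Mochizuki2012, status: disputed] -/
theorem cor312Of_of_hBand {I : ThetaVolumeInput (fieldOfModuli E) K} (hI : ThetaData.IsVolumeInputOf D I)
    (hH : RHHeightClass.HBand (pilotDataOfK D K)) : I.Cor312Of :=
  Conditional.GenuineK.cor312Of_of_SH D K M archPk archSub Ψ act Mmod region frobAdm frobLogvol frobΨ frobMmod unitImage ballImage thetaDiv n
    lat sig split qData (exists_realising_thetaIdeles_pilotDataOfK D).choose (exists_realising_qIdeles_pilotDataOfK D).choose
    (fun _ => (settingPrVolSharp (pilotDataOfK D K) (logvAnalytic_analyticLogv (F := K)) M archPk archSub Ψ act Mmod region n lat sig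
        split qData (exists_realising_qIdeles_pilotDataOfK D).choose (exists_realising_thetaIdeles_pilotDataOfK D).choose
        (exists_realising_qIdeles_pilotDataOfK D).choose_spec.1 (exists_realising_qIdeles_pilotDataOfK D).choose_spec.2.1).qRegion) qK
    hI (exists_realising_qIdeles_pilotDataOfK D).choose_spec.1 (exists_realising_qIdeles_pilotDataOfK D).choose_spec.2.1
    (exists_realising_thetaIdeles_pilotDataOfK D).choose_spec.1 (exists_realising_thetaIdeles_pilotDataOfK D).choose_spec.2.1
    (exists_realising_qIdeles_pilotDataOfK D).choose_spec.2.2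
    (RH2SigmaHull.pilotKummerCompatHull_chosen_of_hBand D M archPk archSub Ψ act Mmod region frobAdm frobLogvol frobΨ frobMmod unitImage
      ballImage thetaDiv n lat sig split qData qK hH)
    (fun _ _ => rfl)
    (negLogTheta_settingPrVolSharp_pilotDataOfK_le_genuine D M archPk archSub Ψ act Mmod region n lat sig split qData
      (exists_realising_qIdeles_pilotDataOfK D).choose (exists_realising_thetaIdeles_pilotDataOfK D).choose
      (exists_realising_qIdeles_pilotDataOfK D).choose_spec.1 (exists_realising_qIdeles_pilotDataOfK D).choose_spec.2.1
      (exists_realising_thetaIdeles_pilotDataOfK D).choose_spec.1 (exists_realising_thetaIdeles_pilotDataOfK D).choose_spec.2.2 hI)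

end Cor312


end Summit.ABC.IUTFork.Repair.RHHeightClassSigma

end
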